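import Summits.Langlands.Langlands.Theses.CofinitePrimeSplit

/-!
# Route CofinitePrimeSplit — Assembly

The assembly item (stmt-Langlands-27659) of the child route `CofinitePrimeSplit` (decomp-langlands lens-5 gen 16; `--refines route-Langlands-RootDecomp1:NoRegularMonodromyIrreducible`, edge split, depth 1) for
NRM = `RootDecomp1.NoRegularMonodromyIrreducible` (stmt-Langlands-31315):
`CofinitePrimeIrreducible → IrreduciblePrimeTransport → RootDecomp1.SemisimpleAvatar → RootDecomp1.NoRegularMonodromyIrreducible`.

This is literally the type of the route file's sorry-free deciding theorem `Summit.Langlands.Langlands.Theses.CofinitePrimeSplit.closes`.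
Nothing here proves `Langlands` (nor the parent piece): the assembly records only that the three binders of the route (the two prime-aspect cells and the parent item E = `SemisimpleAvatar` by name), taken together,
imply the parent piece by name.
-/

set_option linter.dupNamespace false -- project-wide option (lakefile weak.linter.dupNamespace); `Summit.Langlands.Langlands` is the mandated namespace

namespace Summit.Langlands.Langlands.Theorems

/-- **Assembly of route CofinitePrimeSplit** (stmt-Langlands-27659): `CofinitePrimeIrreducible → IrreduciblePrimeTransport → RootDecomp1.SemisimpleAvatar → RootDecomp1.NoRegularMonodromyIrreducible`.
Proof: unfold `Assembly` and apply the route's deciding theorem `Theses.CofinitePrimeSplit.closes`. -/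
theorem cofinitePrimeSplit_assembly_proof :
    Summit.Langlands.Langlands.Theses.CofinitePrimeSplit.Assembly := by
  unfold Summit.Langlands.Langlands.Theses.CofinitePrimeSplit.Assembly
  exact Summit.Langlands.Langlands.Theses.CofinitePrimeSplit.closes

end Summit.Langlands.Langlands.Theorems
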